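import Summits.Ventures.AbcSig.Rows.XTemplateC
import Summits.Ventures.AbcSig.Levels.N9248CP
import Summits.Ventures.AbcSig.Levels.N578
import Summits.Ventures.AbcSig.Levels.N9248

/-!
# Venture AbcSig — ROW `XnYn17Z2`: `xⁿ + yⁿ = 17 z²`, Eisenstein residues DISCHARGED IN THE KERNEL
(GENERATED by p-lean gen3/leanrow_c1x.py)

HONEST FRAMING. A row of a COMPUTATION cell (`pub-abcsig`); a CONDITIONAL theorem, no claim on ABC or any summit.
Hypotheses: `BS04Package` (CITED: [BS04] Lemma 3.3 + (3.1) + Lemma 4.2);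
`DataComplete` at the level(s) 578, 9248 and `Refines` for the discharged orbits (COMPUTED: certified engine level
files); and the listed per-orbit exclusions `hX_…` (CITED; the row of record's R5 names the printed argument / module
for each). Everything else is kernel-checked (`Rows/XTemplateC.lean`, `Levels/N….lean`, the discharge files
`Levels/N…M6Chi.lean` / `Levels/N…M6P.lean`). Exponent range: prime `n ≥ 11`, n ∉ [11, 17].
Residues closed IN THE KERNEL: N9248 orbit_9248_50 @ 41: KERNEL (cp, cp_9248_50_n41_excludes); N9248 orbit_9248_50 @ 116657: KERNEL (cp, cp_9248_50_n116657_excludes).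
Residues / orbits left as CITED hypotheses: N578 orbit_578_1: not sieve-eliminable -> CITED hX_; N9248 orbit_9248_1: not sieve-eliminable -> CITED hX_; N9248 orbit_9248_2: not sieve-eliminable -> CITED hX_; N9248 orbit_9248_3: not sieve-eliminable -> CITED hX_; N9248 orbit_9248_4: not sieve-eliminable -> CITED hX_; N9248 orbit_9248_5: not sieve-eliminable -> CITED hX_; N9248 orbit_9248_6: not sieve-eliminable -> CITED hX_; N9248 orbit_9248_7: not sieve-eliminable -> CITED hX_; N9248 orbit_9248_8: not sieve-eliminable -> CITED hX_; N9248 orbit_9248_9: not sieve-eliminable -> CITED hX_.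
Row of record: `census/rows/C1/C1-C17-all.md` (sha256 `3ee2d9832ad71618…`; SIGNED 2026-08-22T09:55:38Z): [BS04, Thm 1.1] C = 17 (REPRODUCTION of the printed theorem; n = 11 is the printed exception resolved by [Bruin] and NOT claimed here; n = 17 divides C; n = 7 open): xⁿ + yⁿ = 17z² has no primitive solution for every prime n ≥ 13, n ≠ 17, both parities. Levels 578 (xy even; the cell's STEP-0 level file) and 9248 (xy odd; [BS04]'s 'largest level we treat'; generated here, parts). The nine rational/CM orbits 9248.1–9 are excluded by [BS04, Prop. 4.4 / 4.6] (CITED per orbit, exactly the printed list p. 42); 578.1 by Prop. 4.4 (CITED); the residual exponents 41 and 116657 of 9248.50 in the ℤ[θ]-basis certificate are index artefacts, killed IN THE KERNEL by the norm form [BS04 Prop 4.3] at ℓ = 3 (Levels/N9248CP.lean) — compare [BS04, p. 43]'s printed norms for this very form.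
-/

namespace Summit.Ventures.AbcSig

/-- Row `XnYn17Z2`: no primitive solution of `xⁿ + yⁿ = 17 z²` for prime `n ≥ 11`, `n ∉ [11, 17]`,
conditional on the named hypotheses (module-M6/M6χ residues discharged in the kernel). -/
theorem xrow_XnYn17Z2 (M : NewformModel) (hP : M.BS04Package)
    (hD578 : M.DataComplete 578 level578Orbits) (hD9248 : M.DataComplete 9248 level9248Orbits)
    (hRcp_orbit_9248_50 : M.RefinesCP 9248 orbit_9248_50 cp_9248_50)
    (n : ℕ) (hn : n.Prime) (hmin : 11 ≤ n) (hres : n ∉ ([11, 17] : List ℕ))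
    (hX_orbit_578_1 : M.Excludes 578 orbit_578_1
      (fun S => S.A = 1 ∧ S.B = 1 ∧ S.C = 17 ∧ S.n = n ∧ 2 ∣ S.a * S.b))
    (hX_orbit_9248_1 : M.Excludes 9248 orbit_9248_1
      (fun S => S.A = 1 ∧ S.B = 1 ∧ S.C = 17 ∧ S.n = n ∧ ¬ 2 ∣ S.a * S.b))
    (hX_orbit_9248_2 : M.Excludes 9248 orbit_9248_2
      (fun S => S.A = 1 ∧ S.B = 1 ∧ S.C = 17 ∧ S.n = n ∧ ¬ 2 ∣ S.a * S.b))
    (hX_orbit_9248_3 : M.Excludes 9248 orbit_9248_3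
      (fun S => S.A = 1 ∧ S.B = 1 ∧ S.C = 17 ∧ S.n = n ∧ ¬ 2 ∣ S.a * S.b))
    (hX_orbit_9248_4 : M.Excludes 9248 orbit_9248_4
      (fun S => S.A = 1 ∧ S.B = 1 ∧ S.C = 17 ∧ S.n = n ∧ ¬ 2 ∣ S.a * S.b))
    (hX_orbit_9248_5 : M.Excludes 9248 orbit_9248_5
      (fun S => S.A = 1 ∧ S.B = 1 ∧ S.C = 17 ∧ S.n = n ∧ ¬ 2 ∣ S.a * S.b))
    (hX_orbit_9248_6 : M.Excludes 9248 orbit_9248_6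
      (fun S => S.A = 1 ∧ S.B = 1 ∧ S.C = 17 ∧ S.n = n ∧ ¬ 2 ∣ S.a * S.b))
    (hX_orbit_9248_7 : M.Excludes 9248 orbit_9248_7
      (fun S => S.A = 1 ∧ S.B = 1 ∧ S.C = 17 ∧ S.n = n ∧ ¬ 2 ∣ S.a * S.b))
    (hX_orbit_9248_8 : M.Excludes 9248 orbit_9248_8
      (fun S => S.A = 1 ∧ S.B = 1 ∧ S.C = 17 ∧ S.n = n ∧ ¬ 2 ∣ S.a * S.b))
    (hX_orbit_9248_9 : M.Excludes 9248 orbit_9248_9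
      (fun S => S.A = 1 ∧ S.B = 1 ∧ S.C = 17 ∧ S.n = n ∧ ¬ 2 ∣ S.a * S.b))
    (a b c : ℤ) : ¬ IsPrimitiveSolution 1 1 17 n a b c := by
  have h7 : 7 ≤ n := by omega
  have hC : Nat.Prime 17 := by norm_num
  have hsq : Squarefree (17 : ℕ) := (Nat.prime_iff.mp hC).squarefree
  have hnC : ¬ n ∣ 17 := by
    intro h
    simp only [List.mem_cons, List.not_mem_nil, or_false] at hres; rcases (Nat.dvd_prime hC).mp h with h1 | h1 <;> omega
  exact xrow_template 17 (by norm_num) hsq (by decide) M hP hD578 hD9248 n hn h7 hnC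
    (level578_sieve n hn h7 (fun o => M.Excludes 578 o
      (fun S => S.A = 1 ∧ S.B = 1 ∧ S.C = 17 ∧ S.n = n ∧ 2 ∣ S.a * S.b) ∨ M.ExcludesStd 578 o n) (Or.inl hX_orbit_578_1) (fun hmem => by
      obtain rfl : n = 7 := by simpa using hmem
      omega) (fun hmem => by
      obtain rfl : n = 7 := by simpa using hmem
      omega) (fun hmem => by
      obtain rfl : n = 17 := by simpa using hmem
      exact absurd (by simp) hres) (fun hmem => by
      obtain rfl : n = 17 := by simpa using hmem
      exact absurd (by simp) hres))
    (level9248_sieve n hn h7 (fun o => M.Excludes 9248 o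
      (fun S => S.A = 1 ∧ S.B = 1 ∧ S.C = 17 ∧ S.n = n ∧ ¬ 2 ∣ S.a * S.b) ∨ M.ExcludesStd 9248 o n) (Or.inl hX_orbit_9248_1) (Or.inl hX_orbit_9248_2) (Or.inl hX_orbit_9248_3) (Or.inl hX_orbit_9248_4) (Or.inl hX_orbit_9248_5) (Or.inl hX_orbit_9248_6) (Or.inl hX_orbit_9248_7) (Or.inl hX_orbit_9248_8) (Or.inl hX_orbit_9248_9) (fun hmem => by
      obtain rfl : n = 7 := by simpa using hmem
      omega) (fun hmem => by
      obtain rfl : n = 7 := by simpa using hmem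
      omega) (fun hmem => by
      obtain rfl : n = 7 := by simpa using hmem
      omega) (fun hmem => by
      obtain rfl : n = 7 := by simpa using hmem
      omega) (fun hmem => by
      obtain rfl : n = 7 := by simpa using hmem
      omega) (fun hmem => by
      obtain rfl : n = 11 := by simpa using hmem
      exact absurd (by simp) hres) (fun hmem => by
      obtain rfl : n = 11 := by simpa using hmem
      exact absurd (by simp) hres) (fun hmem => by
      obtain rfl : n = 11 := by simpa using hmem
      exact absurd (by simp) hres) (fun hmem => by
      obtain rfl : n = 11 := by simpa using hmem
      exact absurd (by simp) hres) (fun hmem => by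
      rcases (by simpa using hmem : n = 7 ∨ n = 17) with rfl | rfl
      · omega
      · exact absurd (by simp) hres) (fun hmem => by
      obtain rfl : n = 11 := by simpa using hmem
      exact absurd (by simp) hres) (fun hmem => by
      obtain rfl : n = 17 := by simpa using hmem
      exact absurd (by simp) hres) (fun hmem => by
      obtain rfl : n = 17 := by simpa using hmem
      exact absurd (by simp) hres) (fun hmem => by
      rcases (by simpa using hmem : n = 7 ∨ n = 17 ∨ n = 41 ∨ n = 116657) with rfl | rfl | rfl | rfl
      · omega
      · exact absurd (by simp) hres
      · exact Or.inr (cp_9248_50_n41_excludes M hP hRcp_orbit_9248_50)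
      · exact Or.inr (cp_9248_50_n116657_excludes M hP hRcp_orbit_9248_50)))
    a b c

end Summit.Ventures.AbcSig
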